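import Literature.NumberTheory.EllipticCurves.TunnellFormsCuspidalProofs
import Literature.NumberTheory.EllipticCurves.HalfIntegralWeightFormsProofs
import Literature.NumberTheory.EllipticCurves.ModularCurveGenusBoundProofs
import HarnessLib

/-!
# Weight-`2` theta products on `Γ₀(128)`: `θ_t ∈ M_{1/2}(128, χ_t)`, products of half-integral
# weight forms, and `S_{4/2}(128, 1) ↪ S₂(Γ₀(128))` with `dim ≤ g(X₀(128)) = 9`

First file of an elementary route to the dimension input (CO) "`{g θ₂, g θ₈, g θ₃₂}` is a basis of
`S_{3/2}(128, 1)`" of Tunnell 1983, Theorem 2 (p. 327, citing Cohen–Oesterlé [3] for the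
dimension `3`). The route replaces the dimension formula in weight `3/2` by the tree's bound
`dim S₂(Γ₀(N)) ≤ g(X₀(N))` (`finrank_cuspForm_two_le_genusX0`, Manin) at `N = 128`, `g = 9`,
through the maps `f ↦ f θ₁`, `f ↦ f θ₄` from `S_{3/2}(128, 1)` to `S₂(Γ₀(128))`. This file PROVES
the function-theoretic inputs, in the framework `halfIntModularForms k N χ` /
`halfIntCuspForms k N χ` of `HalfIntegralWeightForms` (weight `k/2`):

* `isBoundedAtImInfty_slashSq_thetaMul` — `θ_t(gz)²/(cz + d)` is bounded at `i∞` for every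
  `g ∈ SL₂(ℤ)` (`t ≥ 1`), from the cusp expansions of `TunnellThetaCuspExpansionProofs`;
  with `thetaMul_smul` this gives **`θ₁, θ₄, θ₁₆ ∈ M_{1/2}(128, 1)` and
  `θ₂, θ₈, θ₃₂ ∈ M_{1/2}(128, χ₂)`** (`thetaMul_*_mem_halfIntModularForms`; Tunnell p. 326:
  "`θ_t` is a modular form of weight `1/2`, level `4t` and character `χ_t`").
* `IsThetaAutomorphic.mul`, `slashSq_mul`, `mul_mem_halfIntCuspForms` —
  **`S_{k₁/2}(N, χ₁) · M_{k₂/2}(N, χ₂) ⊆ S_{(k₁+k₂)/2}(N, χ₁χ₂)`**.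
* `apply_smul_eq_of_mem_four` — members of `M_{4/2}(N, 1)` (`4 ∣ N`) satisfy
  `F(γz) = (cz + d)² F(z)` on `Γ₀(N)` (`j(γ, z)⁴ = (cz + d)²`); `cuspFormTwoOfMem`,
  `toCuspFormTwo` — **the injective linear map `S_{4/2}(N, 1) → CuspForm (Γ₀(N)) 2`**; hence
  `S_{4/2}(N, 1)` is finite-dimensional with `dim S_{4/2}(N, 1) ≤ dim S₂(Γ₀(N)) ≤ g(X₀(N))`
  (`finrank_halfIntCuspForms_four_le_genusX0`), and **`dim S_{4/2}(128, 1) ≤ 9`**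
  (`gamma0_data_128`, `genusX0_128`, `finrank_halfIntCuspForms_four_128_le`).
* **The nine weight-`2` theta products `g θ_s θ_t ∈ S_{4/2}(128, 1)`**, `2st` a square:
  `(s, t) ∈ {(2,1), (8,1), (32,1), (2,4), (8,4), (32,4), (2,16), (8,16), (32,16)}`
  (`tunnellForm_mul_thetaMul_mem`), and `f θ₁, f θ₄ ∈ S_{4/2}(128, 1)` for `f ∈ S_{3/2}(128, 1)`,
  `f θ₂, f θ₈ ∈ S_{4/2}(128, 1)` for `f ∈ S_{3/2}(128, χ₂)` (`mul_thetaMul_mem_of_mem_triv/chi2`).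

No named facts are introduced; the only definitions are the bundling maps `cuspFormTwoOfMem`,
`toCuspFormTwo`. The sequel computes the `q`-expansions of the nine products, shows that they span
`S_{4/2}(128, 1)`, and derives (CO).

## References

* J. B. Tunnell, *A classical Diophantine problem and modular forms of weight 3/2*, Invent. Math.
  72 (1983) 323–334, p. 326 (`θ_t ∈ M_{1/2}(4t, χ_t)`), p. 327 (the bases of `S_{3/2}(128, χ)`).
  [Tunnell1983Congruent]
* G. Shimura, *On modular forms of half integral weight*, Ann. of Math. 97 (1973) 440–481, §1
  (`M_{k/2}(N, χ) · M_{l/2}(N, ψ) ⊆ M_{(k+l)/2}(N, χψ)`, `M_{4/2}(N, χ) = M₂(Γ₀(N), χ)`).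
  [Shimura1973HalfIntegral]
* F. Diamond, J. Shurman, *A first course in modular forms*, GTM 228 (2005), Thm. 3.5.1
  (`dim S₂(Γ₀(N)) = g`), Fig. 3.3. [DiamondShurman2005]
-/

noncomputable section

open scoped MatrixGroups NumberTheorySymbols ModularForm Manifold

open UpperHalfPlane hiding I
open Complex Filter Topology CongruenceSubgroup
open scoped Real

namespace Literature.NumberTheory.EllipticCurves.Tunnell1983

open Literature.NumberTheory.EllipticCurves.ModularForms

/-! ### `θ_t` is bounded at every cusp: `θ_t(gz)²/(cz + d) = O(1)` at `i∞` -/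

/-- `θ_t` is bounded at `i∞` (`|θ(τ) - 1| ≤ 2e^{-π Im τ}/(1 - e^{-π Im τ})`, `τ = 2tz`). [folklore] -/
theorem isBoundedAtImInfty_thetaMul {t : ℕ} (ht : 0 < t) : IsBoundedAtImInfty (thetaMul t) := by
  rw [isBoundedAtImInfty_iff]
  refine ⟨1 + 2 / (1 - Real.exp (-π)) * 1, 1, fun z hz ↦ ?_⟩
  rw [thetaMul_eq_shimuraTheta ht, shimuraTheta]
  set τ : ℂ := 2 * ((UpperHalfPlane.mk ((t : ℂ) * z) (mul_im_pos ht z) : ℍ) : ℂ) with hτ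
  have hτim : τ.im = 2 * t * z.im := by
    rw [hτ]
    show (2 * ((t : ℂ) * (z : ℂ))).im = 2 * t * z.im
    simp [mul_assoc]
  have hτpos : 0 < τ.im := by rw [hτim]; positivity
  have hb := norm_jacobiTheta_sub_one_le hτpos
  have hge : π ≤ π * τ.im := by
    rw [hτim]
    have h1 : (1 : ℝ) ≤ 2 * t * z.im := by
      have ht1 : (1 : ℝ) ≤ t := by exact_mod_cast ht
      nlinarith
    nlinarith [Real.pi_pos]
  have hexp : Real.exp (-π * τ.im) ≤ Real.exp (-π) := Real.exp_le_exp.mpr (by linarith)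
  have hexp1 : Real.exp (-π) < 1 := by
    rw [← Real.exp_zero]
    exact Real.exp_lt_exp.mpr (by linarith [Real.pi_pos])
  have hexpτ1 : Real.exp (-π * τ.im) < 1 := lt_of_le_of_lt hexp hexp1
  have hden : 0 < 1 - Real.exp (-π) := by linarith
  have hdenτ : 0 < 1 - Real.exp (-π * τ.im) := by linarith
  have h1 : 2 / (1 - Real.exp (-π * τ.im)) ≤ 2 / (1 - Real.exp (-π)) :=
    div_le_div_of_nonneg_left (by norm_num) hden (by linarith)
  have h2 : 2 / (1 - Real.exp (-π * τ.im)) * Real.exp (-π * τ.im) ≤ 2 / (1 - Real.exp (-π)) * 1 :=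
    mul_le_mul h1 hexpτ1.le (Real.exp_pos _).le (by positivity)
  calc ‖jacobiTheta τ‖ = ‖(jacobiTheta τ - 1) + 1‖ := by ring_nf
    _ ≤ ‖jacobiTheta τ - 1‖ + ‖(1 : ℂ)‖ := norm_add_le _ _
    _ ≤ 2 / (1 - Real.exp (-π)) * 1 + 1 := by rw [norm_one]; linarith
    _ = 1 + 2 / (1 - Real.exp (-π)) * 1 := by ring

section Pos

variable {c : ℕ} [NeZero c]

/-- **`θ_t(gz)²/(cz + d)` is bounded at `i∞` for `c > 0`**: it equals `(θ_t(gz)/P(z))² · P(z)²/(cz + d)`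
with `P(z)²/(cz + d) = 1/(2i)` and `θ_t(gz)/P(z)` convergent (`exists_tendsto_thetaMul_div_prefactor`).
[folklore] -/
theorem isBoundedAtImInfty_slashSq_thetaMul_of_pos {t : ℕ} (ht : 0 < t) {g : SL(2, ℤ)}
    (hc : (g 1 0 : ℤ) = c) : IsBoundedAtImInfty (slashSq 1 (thetaMul t) g) := by
  obtain ⟨L, hL⟩ := exists_tendsto_thetaMul_div_prefactor hc (s := t) ht
  have hK := (hL.pow 2).mul_const (1 / (2 * I))
  have heq : slashSq 1 (thetaMul t) g = fun z : ℍ ↦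
      (thetaMul t (g • z) / (1 / (2 * I / ((c : ℂ) * z + g 1 1)) ^ (1 / 2 : ℂ))) ^ 2 * (1 / (2 * I)) := by
    funext z
    have hsq : (1 / (2 * I / ((c : ℂ) * z + g 1 1)) ^ (1 / 2 : ℂ)) ^ 2 / ((c : ℂ) * z + g 1 1) =
        1 / (2 * I) := prefactor_sq_div (c := c) (g 1 1) z
    have hP0 : 1 / (2 * I / ((c : ℂ) * z + g 1 1)) ^ (1 / 2 : ℂ) ≠ 0 := prefactor_ne_zero (c := c) (g 1 1) z
    have hw := im_denom_pos (c := c) (g 1 1) z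
    have hw0 : (c : ℂ) * z + g 1 1 ≠ 0 := by
      intro h; rw [h] at hw; simp at hw
    have hX : (2 * I / ((c : ℂ) * z + g 1 1)) ^ (1 / 2 : ℂ) ≠ 0 := by
      rw [Ne, Complex.cpow_eq_zero_iff, not_and_or]
      exact Or.inl (two_I_div_denom_ne_zero (c := c) (g 1 1) z)
    simp only [slashSq, pow_one]
    rw [ModularGroup.denom_apply, hc, ← hsq]
    push_cast
    field_simp
  rw [heq]
  exact hK.isBigO_one ℝ

end Pos

/-- `slashSq 1 f (-g) = - slashSq 1 f g`-type identity in the form needed: for `c < 0` the bound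
transfers from `-g` (`(-g)z = gz`, `denom(-g) = -denom(g)`, norms agree). [folklore] -/
theorem isBoundedAtImInfty_slashSq_thetaMul_of_neg {t : ℕ} (ht : 0 < t) {g : SL(2, ℤ)}
    (hneg : (g 1 0 : ℤ) < 0) : IsBoundedAtImInfty (slashSq 1 (thetaMul t) g) := by
  set g' := -g with hg'
  have hc' : ((g' 1 0 : ℤ)) = ((g 1 0).natAbs : ℕ) := by
    rw [hg', SL_neg_apply, Int.ofNat_natAbs_of_nonpos hneg.le]
  haveI : NeZero (g 1 0 : ℤ).natAbs := ⟨Int.natAbs_ne_zero.mpr hneg.ne⟩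
  have key := isBoundedAtImInfty_slashSq_thetaMul_of_pos ht hc'
  have heq : slashSq 1 (thetaMul t) g = -slashSq 1 (thetaMul t) g' := by
    funext z
    simp only [slashSq, Pi.neg_apply, pow_one]
    rw [hg', ModularGroup.SL_neg_smul, ModularGroup.denom_apply, ModularGroup.denom_apply,
      SL_neg_apply, SL_neg_apply]
    push_cast
    have hX := sl_denom_ne_zero g z
    have e' : -((g 1 0 : ℤ) : ℂ) * z + -((g 1 1 : ℤ) : ℂ) = -(((g 1 0 : ℤ) : ℂ) * z + (g 1 1 : ℤ)) := by
      ring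
    rw [e', div_neg, neg_neg]
  rw [heq]
  exact key.neg_left

/-- `c = 0`: `g = ±Tⁿ`, `θ_t(gz)²/(±1) = ±θ_t(z)²` is bounded at `i∞`. [folklore] -/
theorem isBoundedAtImInfty_slashSq_thetaMul_of_zero {t : ℕ} (ht : 0 < t) {g : SL(2, ℤ)}
    (hzero : (g 1 0 : ℤ) = 0) : IsBoundedAtImInfty (slashSq 1 (thetaMul t) g) := by
  have h1 := det_eq_one' g
  rw [hzero, mul_zero, sub_zero] at h1
  have heq : slashSq 1 (thetaMul t) g =
      fun z : ℍ ↦ ((g 1 1 : ℤ) : ℂ) * (thetaMul t * thetaMul t) z := by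
    funext z
    simp only [slashSq, pow_one, Pi.mul_apply]
    rw [smul_eq_vadd_of_apply_one_zero_eq_zero hzero z, thetaMul_vadd_intCast,
      ModularGroup.denom_apply, hzero]
    simp only [Int.cast_zero, zero_mul, zero_add]
    have hd1 : ((g 1 1 : ℤ) : ℂ) * (g 1 1 : ℤ) = 1 := by
      rcases Int.eq_one_or_neg_one_of_mul_eq_one' h1 with ⟨-, h⟩ | ⟨-, h⟩ <;> rw [h] <;> norm_num
    rw [div_eq_iff (by intro h0; rw [h0, mul_zero] at hd1; exact zero_ne_one hd1)]
    linear_combination -(thetaMul t z ^ 2) * hd1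
  rw [heq]
  exact ((isBoundedAtImInfty_thetaMul ht).mul (isBoundedAtImInfty_thetaMul ht)).const_mul_left
    ((g 1 1 : ℤ) : ℂ)

/-- **`θ_t` is holomorphic at every cusp** (`t ≥ 1`): `θ_t(gz)²/(cz + d)` is bounded at `i∞` for
every `g ∈ SL₂(ℤ)` — the cusp condition of `halfIntModularForms 1 N χ`. [cite: Tunnell1983Congruent, p. 326] -/
theorem isBoundedAtImInfty_slashSq_thetaMul {t : ℕ} (ht : 0 < t) (g : SL(2, ℤ)) :
    IsBoundedAtImInfty (slashSq 1 (thetaMul t) g) := by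
  rcases lt_trichotomy (g 1 0 : ℤ) 0 with hneg | hzero | hpos
  · exact isBoundedAtImInfty_slashSq_thetaMul_of_neg ht hneg
  · exact isBoundedAtImInfty_slashSq_thetaMul_of_zero ht hzero
  · haveI : NeZero (g 1 0 : ℤ).natAbs := ⟨Int.natAbs_ne_zero.mpr hpos.ne'⟩
    exact isBoundedAtImInfty_slashSq_thetaMul_of_pos (c := (g 1 0 : ℤ).natAbs) ht
      (Int.natAbs_of_nonneg hpos.le).symm

/-! ### `θ_t ∈ M_{1/2}(128, χ_t)` for `t ∣ 32` -/

/-- `θ_t` is holomorphic on `ℍ` (`θ_t(z) = θ(2·t z)` in terms of Mathlib's `jacobiTheta`). [folklore] -/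
theorem mdifferentiable_thetaMul {t : ℕ} (ht : 0 < t) : MDiff (thetaMul t) := by
  have he : thetaMul t = fun z : ℍ ↦ jacobiTheta (2 * ((t : ℂ) * z)) := by
    funext z
    rw [thetaMul_eq_shimuraTheta ht]
    rfl
  rw [he, UpperHalfPlane.mdifferentiable_iff]
  intro w hw
  have hw' : 0 < ((t : ℂ) * w).im := by
    rw [Complex.mul_im, Complex.natCast_re, Complex.natCast_im, zero_mul, add_zero]
    exact mul_pos (by exact_mod_cast ht) hw
  have h2 : 0 < (2 * ((t : ℂ) * w)).im := by simpa using hw'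
  have hlin : DifferentiableAt ℂ (fun w : ℂ ↦ 2 * ((t : ℂ) * w)) w :=
    (differentiableAt_id.const_mul (t : ℂ)).const_mul (2 : ℂ)
  have hd : DifferentiableAt ℂ (jacobiTheta ∘ fun w : ℂ ↦ 2 * ((t : ℂ) * w)) w :=
    (differentiableAt_jacobiTheta h2).comp w hlin
  refine (hd.congr_of_eventuallyEq ?_).differentiableWithinAt
  filter_upwards [(Complex.continuous_im.isOpen_preimage _ isOpen_Ioi).mem_nhds hw] with u hu
  simp only [Function.comp_apply, ofComplex_apply_of_im_pos hu, UpperHalfPlane.coe_mk]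

/-- `(4/n) = (16/n) = 1` and `(1/n) = 1` packaged: `(t/n) = 1` for `t ∈ {1, 4, 16}`, `n` odd. [folklore] -/
theorem jacobiSym_eq_one_of_sq {t : ℕ} (ht : t = 1 ∨ t = 4 ∨ t = 16) {n : ℕ} (hn : Odd n) :
    J(t | n) = 1 := by
  rcases ht with rfl | rfl | rfl
  · rw [Nat.cast_one, jacobiSym.one_left]
  · rw [show ((4 : ℕ) : ℤ) = 4 by norm_num]
    exact jacobiSym.at_four hn
  · rw [show ((16 : ℕ) : ℤ) = 16 by norm_num]
    exact jacobiSym_sixteen hn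

/-- **Theta-automorphy of `θ_t`, `t ∈ {1, 4, 16}`, of weight `1/2`, level `128`, trivial character**:
`θ_t(γz) θ(z) = θ(γz) θ_t(z)` on `Γ₀(128)` (`θ_t(γz) = (t/|d|) j(γ,z) θ_t(z)` with `(t/·) = 1`,
`θ(γz) = j(γ,z) θ(z)`). [cite: Tunnell1983Congruent, p. 326] -/
theorem isThetaAutomorphic_thetaMul_triv {t : ℕ} (ht : t = 1 ∨ t = 4 ∨ t = 16) :
    IsThetaAutomorphic 1 128 1 (thetaMul t) := by
  have htpos : 0 < t := by rcases ht with rfl | rfl | rfl <;> norm_num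
  have h4t : (4 * t : ℤ) ∣ 128 := by rcases ht with rfl | rfl | rfl <;> norm_num
  intro γ hγ z
  have h128 : (128 : ℤ) ∣ γ 1 0 := dvd_entry_of_mem_Gamma0 128 hγ
  have hd : Odd (γ 1 1 : ℤ) :=
    odd_d_of_even_c (even_iff_two_dvd.mpr ((show (2 : ℤ) ∣ 128 by norm_num).trans h128))
  rw [thetaMul_smul htpos (h4t.trans h128) z,
    shimuraTheta_smul_eq_thetaFactor (by norm_num : 4 ∣ 128) hγ z,
    MulChar.one_apply (isUnit_zmod_of_odd hd), jacobiSym_eq_one_of_sq ht (Int.natAbs_odd.mpr hd)]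
  ring

/-- **Theta-automorphy of `θ_t`, `t ∈ {2, 8, 32}`, of weight `1/2`, level `128`, character `χ₂`**:
`θ_t(γz) θ(z) = χ₂(d) θ(γz) θ_t(z)` on `Γ₀(128)` (`(8/·) = (32/·) = (2/·) = χ₂`).
[cite: Tunnell1983Congruent, p. 326] -/
theorem isThetaAutomorphic_thetaMul_chi2 {t : ℕ} (ht : t = 2 ∨ t = 8 ∨ t = 32) :
    IsThetaAutomorphic 1 128 tunnellChar (thetaMul t) := by
  have htpos : 0 < t := by rcases ht with rfl | rfl | rfl <;> norm_num
  have h4t : (4 * t : ℤ) ∣ 128 := by rcases ht with rfl | rfl | rfl <;> norm_num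
  intro γ hγ z
  have h128 : (128 : ℤ) ∣ γ 1 0 := dvd_entry_of_mem_Gamma0 128 hγ
  have hd : Odd (γ 1 1 : ℤ) :=
    odd_d_of_even_c (even_iff_two_dvd.mpr ((show (2 : ℤ) ∣ 128 by norm_num).trans h128))
  have hn : Odd (γ 1 1 : ℤ).natAbs := Int.natAbs_odd.mpr hd
  have hJ : J(t | (γ 1 1 : ℤ).natAbs) = J(2 | (γ 1 1 : ℤ).natAbs) := by
    rcases ht with rfl | rfl | rfl
    · rfl
    · exact_mod_cast jacobiSym_eight hn
    · exact_mod_cast jacobiSym_thirtytwo hn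
  rw [thetaMul_smul htpos (h4t.trans h128) z,
    shimuraTheta_smul_eq_thetaFactor (by norm_num : 4 ∣ 128) hγ z, tunnellChar_apply_of_odd hd, hJ]
  ring

/-- **`θ₁, θ₄, θ₁₆ ∈ M_{1/2}(128, 1)`** ("`θ_t` is a modular form of weight `1/2`, level `4t` and
character `χ_t`", Tunnell p. 326, at level `128`; `χ_t` trivial for square `t`).
[cite: Tunnell1983Congruent, p. 326] -/
theorem thetaMul_mem_halfIntModularForms_triv {t : ℕ} (ht : t = 1 ∨ t = 4 ∨ t = 16) :
    thetaMul t ∈ halfIntModularForms 1 128 1 := by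
  have htpos : 0 < t := by rcases ht with rfl | rfl | rfl <;> norm_num
  exact ⟨mdifferentiable_thetaMul htpos, isThetaAutomorphic_thetaMul_triv ht,
    isBoundedAtImInfty_slashSq_thetaMul htpos⟩

/-- **`θ₂, θ₈, θ₃₂ ∈ M_{1/2}(128, χ₂)`** (`χ_t = (2/·)` for `t = 2, 8, 32`).
[cite: Tunnell1983Congruent, p. 326] -/
theorem thetaMul_mem_halfIntModularForms_chi2 {t : ℕ} (ht : t = 2 ∨ t = 8 ∨ t = 32) :
    thetaMul t ∈ halfIntModularForms 1 128 tunnellChar := by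
  have htpos : 0 < t := by rcases ht with rfl | rfl | rfl <;> norm_num
  exact ⟨mdifferentiable_thetaMul htpos, isThetaAutomorphic_thetaMul_chi2 ht,
    isBoundedAtImInfty_slashSq_thetaMul htpos⟩

/-! ### Products of half-integral weight forms -/

/-- `slashSq` is multiplicative in `(k, f)`: `slashSq (k₁+k₂) (f h) g = slashSq k₁ f g · slashSq k₂ h g`.
[folklore] -/
theorem slashSq_mul (k₁ k₂ : ℕ) (f h : ℍ → ℂ) (g : SL(2, ℤ)) :
    slashSq (k₁ + k₂) (f * h) g = slashSq k₁ f g * slashSq k₂ h g := by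
  funext z
  simp only [slashSq, Pi.mul_apply]
  rw [pow_add, mul_pow, mul_div_mul_comm]

/-- **Products of theta-automorphic functions**: weights and characters multiply
(`f(γz)θ^{k₁} = χ₁(d)θ(γz)^{k₁}f`, `h(γz)θ^{k₂} = χ₂(d)θ(γz)^{k₂}h` give the same for `fh`, `k₁+k₂`,
`χ₁χ₂`). [cite: Shimura1973HalfIntegral, §1] -/
theorem _root_.Literature.NumberTheory.EllipticCurves.ModularForms.IsThetaAutomorphic.mul
    {k₁ k₂ N : ℕ} {χ₁ χ₂ : DirichletCharacter ℂ N} {f h : ℍ → ℂ}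
    (hf : IsThetaAutomorphic k₁ N χ₁ f) (hh : IsThetaAutomorphic k₂ N χ₂ h) :
    IsThetaAutomorphic (k₁ + k₂) N (χ₁ * χ₂) (f * h) := by
  intro γ hγ z
  have e₁ := hf γ hγ z
  have e₂ := hh γ hγ z
  simp only [Pi.mul_apply, MulChar.coeToFun_mul]
  rw [pow_add, pow_add]
  linear_combination h (γ • z) * shimuraTheta z ^ k₂ * e₁ +
    χ₁ ((γ 1 1 : ℤ) : ZMod N) * shimuraTheta (γ • z) ^ k₁ * f z * e₂

/-- **`S_{k₁/2}(N, χ₁) · M_{k₂/2}(N, χ₂) ⊆ S_{(k₁+k₂)/2}(N, χ₁χ₂)`**: a cusp form times a modular form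
of half-integral weights is a cusp form (at each cusp, `slashSq` of the product is the product of a
function tending to `0` and a bounded one). [cite: Shimura1973HalfIntegral, §1] -/
theorem mul_mem_halfIntCuspForms {k₁ k₂ N : ℕ} {χ₁ χ₂ : DirichletCharacter ℂ N} {f h : ℍ → ℂ}
    (hf : f ∈ halfIntCuspForms k₁ N χ₁) (hh : h ∈ halfIntModularForms k₂ N χ₂) :
    f * h ∈ halfIntCuspForms (k₁ + k₂) N (χ₁ * χ₂) := by
  refine ⟨hf.1.mul hh.1, IsThetaAutomorphic.mul hf.2.1 hh.2.1, fun g ↦ ?_⟩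
  rw [slashSq_mul]
  have h0 : Tendsto (slashSq k₁ f g) atImInfty (𝓝 0) := hf.2.2 g
  have hb := hh.2.2 g
  rw [isBoundedAtImInfty_iff] at hb
  obtain ⟨M, A, hM⟩ := hb
  show Tendsto (slashSq k₁ f g * slashSq k₂ h g) atImInfty (𝓝 0)
  rw [tendsto_zero_iff_norm_tendsto_zero] at h0 ⊢
  refine squeeze_zero' (Filter.Eventually.of_forall fun z ↦ norm_nonneg _) ?_
    (by simpa using h0.mul_const (max M 0))
  rw [Filter.eventually_iff_exists_mem]
  refine ⟨{z : ℍ | A ≤ z.im}, ?_, fun z hz ↦ ?_⟩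
  · rw [atImInfty, Filter.mem_comap]
    exact ⟨Set.Ici A, Filter.Ici_mem_atTop A, fun z hz ↦ hz⟩
  · rw [Pi.mul_apply, norm_mul]
    exact mul_le_mul_of_nonneg_left ((hM z hz).trans (le_max_left M 0)) (norm_nonneg _)

/-! ### Weight `4/2 = 2`: `S_{4/2}(N, 1) ↪ S₂(Γ₀(N))` -/

section WeightTwo

variable {N : ℕ} [NeZero N]

/-- `j(γ, z)⁴ = (cz + d)²` (the square of `j(γ,z)² = χ₋₄(d)(cz + d)`). [folklore] -/
theorem thetaFactor_pow_four {c d : ℤ} (h : Int.gcd c d = 1) (z : ℍ) :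
    thetaFactor c d z ^ 4 = ((c : ℂ) * z + d) ^ 2 := by
  rw [show (4 : ℕ) = 2 * 2 by norm_num, pow_mul, thetaFactor_sq h z, mul_pow]
  split_ifs <;> ring

omit [NeZero N] in
/-- **Weight-`2` automorphy from theta-automorphy of weight `4/2`, trivial character**: for
`F ∈ M_{4/2}(N, 1)`, `4 ∣ N`, and `γ = (a b; c d) ∈ Γ₀(N)`, `F(γz) = (cz + d)² F(z)`.
[cite: Shimura1973HalfIntegral, §1] -/
theorem apply_smul_eq_of_mem_four (hN : 4 ∣ N) {F : ℍ → ℂ} (hF : F ∈ halfIntModularForms 4 N 1)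
    {γ : SL(2, ℤ)} (hγ : γ ∈ Gamma0 N) (z : ℍ) :
    F (γ • z) = (((γ 1 0 : ℤ) : ℂ) * z + ((γ 1 1 : ℤ) : ℂ)) ^ 2 * F z := by
  rw [apply_smul_eq_of_mem hN hF hγ z, autFactor, thetaFactor_pow_four (gcd_c_d_eq_one γ),
    MulChar.one_apply (isUnit_d_of_mem_Gamma0 hγ), one_mul]

omit [NeZero N] in
/-- Weight-`2` slash-invariance under `Γ₀(N)` of members of `M_{4/2}(N, 1)`. [folklore] -/
theorem slash_two_eq_of_mem_four (hN : 4 ∣ N) {F : ℍ → ℂ} (hF : F ∈ halfIntModularForms 4 N 1)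
    {γ : SL(2, ℤ)} (hγ : γ ∈ Gamma0 N) : F ∣[(2 : ℤ)] (γ : GL (Fin 2) ℝ) = F := by
  rw [← ModularForm.SL_slash]
  funext z
  rw [ModularForm.SL_slash_apply, apply_smul_eq_of_mem_four hN hF hγ z, ModularGroup.denom_apply]
  have hX := sl_denom_ne_zero γ z
  rw [zpow_neg, zpow_two]
  field_simp

/-- `a (D⁻²)² = a/D⁴` in `ℝ`. [folklore] -/
theorem mul_zpow_neg_two_sq (a D : ℝ) : a * (D ^ (-2 : ℤ)) ^ 2 = a / D ^ 4 := by
  rw [zpow_neg, zpow_two]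
  ring

omit [NeZero N] in
/-- `|(F |₂ g)(z)|² = |slashSq 4 F g (z)|`. [folklore] -/
theorem norm_slash_two_sq (F : ℍ → ℂ) (g : SL(2, ℤ)) (z : ℍ) :
    ‖(F ∣[(2 : ℤ)] (g : GL (Fin 2) ℝ)) z‖ ^ 2 = ‖slashSq 4 F g z‖ := by
  rw [← ModularForm.SL_slash, ModularForm.SL_slash_apply, slashSq, norm_mul, norm_div, norm_pow,
    norm_pow, norm_zpow, mul_pow]
  exact mul_zpow_neg_two_sq _ _

omit [NeZero N] in
/-- Members of `S_{4/2}(N, 1)` vanish at every cusp in weight `2`: `F |₂ g → 0` at `i∞` for all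
`g ∈ SL₂(ℤ)`. [folklore] -/
theorem isZeroAtImInfty_slash_two_of_mem_four {F : ℍ → ℂ} (hF : F ∈ halfIntCuspForms 4 N 1)
    (g : SL(2, ℤ)) : IsZeroAtImInfty (F ∣[(2 : ℤ)] (g : GL (Fin 2) ℝ)) := by
  have h := hF.2.2 g
  rw [isZeroAtImInfty_iff] at h ⊢
  intro ε hε
  obtain ⟨A, hA⟩ := h (ε ^ 2) (by positivity)
  refine ⟨A, fun z hz ↦ ?_⟩
  have h2 : ‖(F ∣[(2 : ℤ)] (g : GL (Fin 2) ℝ)) z‖ ^ 2 ≤ ε ^ 2 := by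
    rw [norm_slash_two_sq]; exact hA z hz
  calc ‖(F ∣[(2 : ℤ)] (g : GL (Fin 2) ℝ)) z‖
      = Real.sqrt (‖(F ∣[(2 : ℤ)] (g : GL (Fin 2) ℝ)) z‖ ^ 2) := (Real.sqrt_sq (norm_nonneg _)).symm
    _ ≤ Real.sqrt (ε ^ 2) := Real.sqrt_le_sqrt h2
    _ = ε := Real.sqrt_sq hε.le

/-- **The weight-`2` cusp form of level `Γ₀(N)` underlying a member of `S_{4/2}(N, 1)`** (`4 ∣ N`).
[cite: Shimura1973HalfIntegral, §1] -/
def cuspFormTwoOfMem (hN : 4 ∣ N) (F : ℍ → ℂ) (hF : F ∈ halfIntCuspForms 4 N 1) :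
    CuspForm (Gamma0 N) 2 where
  toFun := F
  slash_action_eq' γ hγ := by
    obtain ⟨γ₀, hγ₀, rfl⟩ := hγ
    exact slash_two_eq_of_mem_four hN (halfIntCuspForms_le_halfIntModularForms 4 N 1 hF) hγ₀
  holo' := hF.1
  zero_at_cusps' {c} hc := by
    rw [Subgroup.IsArithmetic.isCusp_iff_isCusp_SL2Z] at hc
    rw [OnePoint.isZeroAt_iff_forall_SL2Z hc]
    intro γ _
    exact isZeroAtImInfty_slash_two_of_mem_four hF γ

/-- The function of `cuspFormTwoOfMem` is `F`. [folklore] -/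
@[simp] theorem cuspFormTwoOfMem_apply (hN : 4 ∣ N) (F : ℍ → ℂ) (hF : F ∈ halfIntCuspForms 4 N 1)
    (z : ℍ) : cuspFormTwoOfMem hN F hF z = F z := rfl

variable (N) in
/-- **The linear map `S_{4/2}(N, 1) → S₂(Γ₀(N))`** (`4 ∣ N`). [cite: Shimura1973HalfIntegral, §1] -/
def toCuspFormTwo (hN : 4 ∣ N) : halfIntCuspForms 4 N 1 →ₗ[ℂ] CuspForm (Gamma0 N) 2 where
  toFun F := cuspFormTwoOfMem hN F.1 F.2
  map_add' F G := by ext z; rfl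
  map_smul' a F := by ext z; rfl

/-- `toCuspFormTwo` is injective (it is the identity on functions). [folklore] -/
theorem toCuspFormTwo_injective (hN : 4 ∣ N) : Function.Injective (toCuspFormTwo N hN) := by
  intro F G h
  apply Subtype.ext
  funext z
  exact congrArg (fun H : CuspForm (Gamma0 N) 2 ↦ H z) h

/-- **`S_{4/2}(N, 1)` is finite-dimensional** (it embeds in `S₂(Γ₀(N))`). [folklore] -/
theorem finiteDimensional_halfIntCuspForms_four (hN : 4 ∣ N) :
    FiniteDimensional ℂ (halfIntCuspForms 4 N 1) :=
  haveI : FiniteDimensional ℂ (CuspForm (Gamma0 N) 2) := finiteDimensional_cuspForm_gamma0 N 2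
  Module.Finite.of_injective (toCuspFormTwo N hN) (toCuspFormTwo_injective hN)

/-- **`dim S_{4/2}(N, 1) ≤ dim S₂(Γ₀(N)) ≤ g(X₀(N))`** (Manin's bound `finrank_cuspForm_two_le_genusX0`).
[cite: DiamondShurman2005, Thm. 3.5.1] -/
theorem finrank_halfIntCuspForms_four_le_genusX0 (hN : 4 ∣ N) :
    Module.finrank ℂ (halfIntCuspForms 4 N 1) ≤ genusX0 N := by
  haveI : FiniteDimensional ℂ (CuspForm (Gamma0 N) 2) := finiteDimensional_cuspForm_gamma0 N 2
  exact (LinearMap.finrank_le_finrank_of_injective (toCuspFormTwo_injective hN)).trans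
    (finrank_cuspForm_two_le_genusX0 N)

end WeightTwo

/-- `μ(Γ₀(128)) = 192`, `ν_∞(Γ₀(128)) = 16`, `ν₂(Γ₀(128)) = ν₃(Γ₀(128)) = 0`
(Diamond–Shurman §3.8, Cor. 3.7.2: `4 ∣ 128`, `2 ≡ 2 (3)`). [folklore] -/
theorem gamma0_data_128 :
    gamma0Index 128 = 192 ∧ nuInfty 128 = 16 ∧ nu₂ 128 = 0 ∧ nu₃ 128 = 0 :=
  ⟨gamma0Index_prime_pow (p := 2) (e := 7) Nat.prime_two (by norm_num),
    by decide, by rw [nu₂_eq_card]; decide, by rw [nu₃_eq_card]; decide⟩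

/-- **`g(X₀(128)) = 9`** (`(12 + 192 - 0 - 0 - 96)/12`; Diamond–Shurman Thm. 3.1.1). [folklore] -/
theorem genusX0_128 : genusX0 128 = 9 := by
  obtain ⟨hμ, hν, h₂, h₃⟩ := gamma0_data_128
  rw [genusX0, hμ, hν, h₂, h₃]

/-- **`S_{4/2}(128, 1)` is finite-dimensional.** [folklore] -/
instance finiteDimensional_halfIntCuspForms_four_128 :
    FiniteDimensional ℂ (halfIntCuspForms 4 128 1) :=
  finiteDimensional_halfIntCuspForms_four (by norm_num)

/-- **`dim S_{4/2}(128, 1) ≤ 9 = g(X₀(128))`.** [cite: DiamondShurman2005, Thm. 3.5.1] -/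
theorem finrank_halfIntCuspForms_four_128_le :
    Module.finrank ℂ (halfIntCuspForms 4 128 1) ≤ 9 :=
  genusX0_128 ▸ finrank_halfIntCuspForms_four_le_genusX0 (by norm_num)

/-! ### The nine weight-`2` theta products `g θ_s θ_t` and the products `f θ_t` -/

/-- `1 · 1 = 1` for Dirichlet characters (used to read `S · M ⊆ S` with trivial characters). [folklore] -/
theorem one_mul_one_dirichlet (N : ℕ) : (1 : DirichletCharacter ℂ N) * 1 = 1 := mul_one 1

/-- `χ₂² = 1`: `tunnellChar * tunnellChar = 1` (a quadratic character). [folklore] -/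
theorem tunnellChar_mul_self : tunnellChar * tunnellChar = 1 := by
  ext u
  rw [MulChar.coeToFun_mul, Pi.mul_apply, MulChar.one_apply u.isUnit]
  set d : ℕ := (u : ZMod 128).val with hd
  have hu : ((d : ℤ) : ZMod 128) = (u : ZMod 128) := by
    rw [Int.cast_natCast, hd, ZMod.natCast_zmod_val]
  have hcop : Nat.Coprime d 128 := ZMod.val_coe_unit_coprime u
  have hodd' : Odd d := by
    rw [Nat.odd_iff]
    by_contra h2
    have he : 2 ∣ d := Nat.dvd_of_mod_eq_zero (by omega)
    have : 2 ∣ Nat.gcd d 128 := Nat.dvd_gcd he ⟨64, by norm_num⟩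
    rw [hcop.gcd_eq_one] at this
    omega
  have hodd : Odd (d : ℤ) := by exact_mod_cast hodd'
  have hgcd : (2 : ℤ).gcd ((d : ℤ).natAbs) = 1 := by
    rw [Int.natAbs_natCast]
    exact int_gcd_two_eq_one hodd'
  rw [← hu, tunnellChar_apply_of_odd hodd, ← Int.cast_mul, ← sq, jacobiSym.sq_one hgcd, Int.cast_one]

/-- **`f θ_t ∈ S_{4/2}(128, 1)` for `f ∈ S_{3/2}(128, 1)` and `t ∈ {1, 4, 16}`.**
[cite: Shimura1973HalfIntegral, §1] -/
theorem mul_thetaMul_mem_of_mem_triv {f : ℍ → ℂ} (hf : f ∈ halfIntCuspForms 3 128 1) {t : ℕ}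
    (ht : t = 1 ∨ t = 4 ∨ t = 16) : f * thetaMul t ∈ halfIntCuspForms 4 128 1 := by
  have h := mul_mem_halfIntCuspForms hf (thetaMul_mem_halfIntModularForms_triv ht)
  rwa [one_mul_one_dirichlet] at h

/-- **`f θ_t ∈ S_{4/2}(128, 1)` for `f ∈ S_{3/2}(128, χ₂)` and `t ∈ {2, 8, 32}`** (`χ₂² = 1`).
[cite: Shimura1973HalfIntegral, §1] -/
theorem mul_thetaMul_mem_of_mem_chi2 {f : ℍ → ℂ} (hf : f ∈ halfIntCuspForms 3 128 tunnellChar)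
    {t : ℕ} (ht : t = 2 ∨ t = 8 ∨ t = 32) : f * thetaMul t ∈ halfIntCuspForms 4 128 1 := by
  have h := mul_mem_halfIntCuspForms hf (thetaMul_mem_halfIntModularForms_chi2 ht)
  rwa [tunnellChar_mul_self] at h

/-- **The nine weight-`2` theta products `g θ_s θ_t ∈ S_{4/2}(128, 1) = S₂(Γ₀(128))`** for
`s ∈ {2, 8, 32}` and `t ∈ {1, 4, 16}` (so that `2st` is a square and the characters cancel):
`g θ₂ θ₁, g θ₈ θ₁, g θ₃₂ θ₁, g θ₂ θ₄, g θ₈ θ₄, g θ₃₂ θ₄, g θ₂ θ₁₆, g θ₈ θ₁₆, g θ₃₂ θ₁₆`.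
[cite: Tunnell1983Congruent, p. 327] -/
theorem tunnellForm_mul_thetaMul_mem {s t : ℕ} (hs : s = 2 ∨ s = 8 ∨ s = 32)
    (ht : t = 1 ∨ t = 4 ∨ t = 16) : tunnellForm s * thetaMul t ∈ halfIntCuspForms 4 128 1 := by
  have hS : tunnellForm s ∈ halfIntCuspForms 3 128 1 := by
    rcases hs with rfl | rfl | rfl
    · exact tunnellForm_two_mem_halfIntCuspForms
    · exact tunnellForm_eight_mem_halfIntCuspForms
    · exact tunnellForm_thirtytwo_mem_halfIntCuspForms
  exact mul_thetaMul_mem_of_mem_triv hS ht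

end Literature.NumberTheory.EllipticCurves.Tunnell1983
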